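import Summits.BirchSwinnertonDyer.BirchSwinnertonDyer.Theorems.ByReductionTypeAtTwoOrdKatoHalfAtTwoIsoSteinbergDefs
import Summits.BirchSwinnertonDyer.BirchSwinnertonDyer.Theorems.SmallImageMuTransferMuTransferX9CoreAssemblyOdd
import Summits.BirchSwinnertonDyer.BirchSwinnertonDyer.Theorems.SmallImageMuTransferMuTransferX9StepFourReciprocity
import Summits.BirchSwinnertonDyer.BirchSwinnertonDyer.Theorems.SmallImageMuTransferMuTransferX9LocalTransversePerfect
import Literature.NumberTheory.EllipticCurves.Kato2004.UniversalNormsIntegralProofs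
import Literature.NumberTheory.GaloisCohomology.PoitouTateNumberField
import HarnessLib

/-!
# STUB-IDEAS k=2 for `stub_port : CoreTheoremATwoResidue` — the RANK-ONE Ω-ROAD (card #9, sign-blind
# transposition primes): PROPOSED HELPER STATEMENTS, typed (plan file; `sorry` = to be proved; nothing booked)

BSD is not proved; the crux `OrdKatoHalfAtTwoIso` is not proved; `stub_port` is not proved. This file only
TYPE-CHECKS the statements of the helper lemmas proposed in `STUB-IDEAS-stub_port-2.md` and the shape of the
composition `coreTwoResidue_of_rankOne` (mirror of `CoreAssembly.coreOdd_of_selmerDual_of_stepsTwoFour`),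
which is PROVED here (axioms: propext, Classical.choice, Quot.sound): `stub_port` ⟸ (H-S) + (H-C) + (H-K) + two
tree facts proved for every prime (`mem_pSmul_of_red_eq_zero_holds`, `poitouTate_sum_localTatePairing_eq_zero_holds ℚ`).
-/

set_option linter.dupNamespace false
set_option autoImplicit false

noncomputable section

open scoped Classical NumberField
open WeierstrassCurve Field IsDedekindDomain NumberField
open Literature.NumberTheory.GaloisRepresentations
open Literature.NumberTheory.GaloisCohomology
open Literature.NumberTheory.EllipticCurves
open Literature.NumberTheory.EllipticCurves.Kato2004
open Literature.NumberTheory.EllipticCurves.Kato2004.EulerSystemValues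
open Summit.BirchSwinnertonDyer.BirchSwinnertonDyer.Rank1Residual
open Summit.BirchSwinnertonDyer.BirchSwinnertonDyer.Rank1Residual.CoreAssembly
open Summit.BirchSwinnertonDyer.BirchSwinnertonDyer.Theorems.SteinbergFibreAtTwo (CoreTheoremATwoResidue)

universe u

namespace Summit.BirchSwinnertonDyer.BirchSwinnertonDyer.Cruxes.OrdKatoHalfAtTwoIso.SignBlindKolyvaginPrimes

/-! ## F3 certificate (decidable): in rank one the «graph case» of the two Chebotarev conditions is harmless.
On `E[2] = 𝔽₂²` with the alternating Weil form `e(x,y) = x₁y₂ + x₂y₁` and `τ` = the coordinate swap (a transposition),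
`e((τ−1)x, x) = e(τx, x) = x₁² + x₂² = 1` for every `x ∉ L := ker(τ − 1)` — whereas at an `E`-split prime the graph
case gives `e(x, λx) = 0` (alternating) and needs the Goursat/second-order rescue of KOLY-MEMO Lemma 5.7.B (`p ≠ 2`). -/
example : ∀ x : ZMod 2 × ZMod 2, x.1 ≠ x.2 → x.2 * x.2 + x.1 * x.1 = 1 := by decide
example : ∀ x : ZMod 2 × ZMod 2, x.1 * x.2 + x.2 * x.1 = 0 := by decide

/-! ## (H-N) the `p = 2` twin of `SelmerDual.iterate_conj_sub_id_eq_zero_of_pow` (the ONLY `p ≠ 2` use on the Selmer side) -/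

/-- (H-N, size S) On a `2`-torsion group a `g` with `g^{2^n} = id` has `(g − id)^{2^n} = g^{2^n} − id = 0`
(Frobenius in characteristic `2`; replaces the binomial/odd argument of `…X9SelmerDualLocalFineNil` l.66–84). -/
theorem iterate_sub_id_eq_zero_of_pow_two {V : Type*} [AddCommGroup V] (hV : ∀ v : V, 2 • v = 0)
    (g : V →+ V) {n : ℕ} (hg : ∀ v, g^[2 ^ n] v = v) (v : V) :
    (⇑(g - AddMonoidHom.id V))^[2 ^ n] v = 0 := by
  sorry

/-! ## (H-S) the Selmer side at `2` — `SelmerDual.stub_selmerDualOdd_holds` with `p ≠ 2, Irr, ¬Surj ↦ p = 2, Surj(2)`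
(`hEP`, `hPT`, `¬Surj` are UNUSED in the odd proof; `Irr` enters via `LevelE.torsionGaloisModule_fixed_eq_zero_of_irr`,
`p ≠ 2` only via (H-N) inside `localP_of`/`exists_uniform_local_exponent(_resLe)`). -/

/-- (H-S, size M, SHARED with the S₃-port road) the Selmer-side statement at `p = 2`. -/
def SelmerSideTwo : Prop :=
  ∀ (W : WeierstrassCurve ℚ) [W.IsElliptic] [W.IsGloballyMinimal]
    (κ : ZpExtension ℚ 2) (γ : absoluteGaloisGroup ℚ),
    W.HasSurjectiveModNGaloisRep 2 → κ.IsCyclotomic → κ.IsTopGenerator γ →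
    ∀ (S₀ : Set (HeightOneSpectrum (𝓞 ℚ))), S₀.Finite →
    ∃ (ε : ℕ) (S : Set (HeightOneSpectrum (𝓞 ℚ))), S.Finite ∧ S₀ ⊆ S ∧
      ∀ (J : ℕ) (y : Literature.NumberTheory.EllipticCurves.subgroupH1 κ.kerSubgroup
          (WeierstrassCurve.geomTorsion W (2 : ℤ))),
        W.torsionToPrimaryH1Sub 2 κ.kerSubgroup y ∈ W.fineSelmerInfty κ →
        (⇑(Literature.NumberTheory.EllipticCurves.conjH1 κ.kerSubgroup
            (WeierstrassCurve.geomTorsion W (2 : ℤ)) γ -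
          AddMonoidHom.id (Literature.NumberTheory.EllipticCurves.subgroupH1 κ.kerSubgroup
            (WeierstrassCurve.geomTorsion W (2 : ℤ)))))^[J] y ≠ 0 →
        ∃ Ψ : galoisCohomology (W.modPTwist 2 κ.invTwist (J + 1)) 1,
          (κ.invTwist.shiftH1 (W.torsionGaloisModule (2 : ℤ))
              (fun P : WeierstrassCurve.geomTorsion W (2 : ℤ) => AddSubgroup.torsionBy.nsmul P)
              (J + 1))^[J] Ψ ≠ 0 ∧
          (∀ v : HeightOneSpectrum (𝓞 ℚ), v ∉ S →
            galoisCohomology.localization (W.modPTwist 2 κ.invTwist (J + 1)) (Sum.inr v) 1 Ψ ∈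
              DiscreteGaloisModule.unramifiedSubgroup
                (GaloisRep.toLocal v (W.modPTwist 2 κ.invTwist (J + 1))) 1) ∧
          (∀ v : HeightOneSpectrum (𝓞 ℚ), v ∈ S →
            galoisCohomology.localization (W.modPTwist 2 κ.invTwist (J + 1)) (Sum.inr v) 1
              ((κ.invTwist.shiftH1 (W.torsionGaloisModule (2 : ℤ))
                (fun P : WeierstrassCurve.geomTorsion W (2 : ℤ) => AddSubgroup.torsionBy.nsmul P)
                (J + 1))^[ε] Ψ) = 0)

/-! ## (H-R) real places on the residue (`Δ < 0`): replaces `StepFour.localization_inl_eq_zero_of_odd` -/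

/-- (H-R, size M, SHARED = the lead's W-Δ) `Δ < 0` ⇒ complex conjugation is a transposition on `E[2]` ⇒
`𝒯_J(E)(χ^{±1}) ≅ 𝔽₂[Gal(ℂ/ℝ)]^J` is an induced `Gal(ℂ/ℝ)`-module ⇒ `H¹(ℝ, 𝒯_J) = 0` (any `ℤ₂`-extension `κ'`
is trivial on an involution, so no cyclotomic hypothesis). -/
theorem localization_inl_modPTwist_eq_zero_of_Δ_neg (W : WeierstrassCurve ℚ) [W.IsElliptic]
    (κ' : ZpExtension ℚ 2) (hΔ : W.Δ < 0) (J : ℕ) (w : InfinitePlace ℚ)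
    (x : galoisCohomology (W.modPTwist 2 κ' J) 1) :
    galoisCohomology.localization (W.modPTwist 2 κ' J) (Sum.inl w) 1 x = 0 := by
  sorry

/-- (H-R′, size S, generic) STEP 4 reciprocity with the archimedean terms as a HYPOTHESIS instead of `n` odd:
`StepFour.localTerm_inr_eq_zero_of_unramified_outside` verbatim with `(hn : Odd n) ↦ (hinf : …)`; same 8-line proof. -/
theorem localTerm_inr_eq_zero_of_unramified_outside_of_inl {K : Type u} [Field K] [NumberField K]
    {M : Type u} [AddCommGroup M] [TopologicalSpace M] [DiscreteTopology M] [Finite M] {n : ℕ} [NeZero n]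
    {inv : LocalInvariants K n} (hPT : inv.SumLocalTermEqZero) (ρ : DiscreteGaloisModule K M)
    (hM : ∀ m : M, n • m = 0) (S : Finset (HeightOneSpectrum (𝓞 K))) (q : HeightOneSpectrum (𝓞 K))
    (x : galoisCohomology ρ 1) (y : galoisCohomology (ρ.tateDual n) 1)
    (hinf : ∀ w : InfinitePlace K, inv.localTerm ρ (Sum.inl w) x y = 0)
    (hI : ∀ v ∉ S, v ≠ q → ∀ t ∈ absInertia (v.adicCompletion K), ∀ m : M,
      GaloisRep.toLocal v ρ t m = m)
    (hID : ∀ v ∉ S, v ≠ q → ∀ t ∈ absInertia (v.adicCompletion K),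
      ∀ f : DiscreteGaloisModule.TateDual K M n, GaloisRep.toLocal v (ρ.tateDual n) t f = f)
    (hx : ∀ v ∉ S, v ≠ q → galoisCohomology.localization ρ (Sum.inr v) 1 x ∈
      DiscreteGaloisModule.unramifiedSubgroup (GaloisRep.toLocal v ρ) 1)
    (hy : ∀ v ∉ S, v ≠ q → galoisCohomology.localization (ρ.tateDual n) (Sum.inr v) 1 y ∈
      DiscreteGaloisModule.unramifiedSubgroup (GaloisRep.toLocal v (ρ.tateDual n)) 1)
    (hS : ∀ v ∈ S, inv.localTerm ρ (Sum.inr v) x y = 0) :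
    inv.localTerm ρ (Sum.inr q) x y = 0 := by
  refine hPT.localTerm_eq_zero ρ hM x y (Sum.inr q) fun v hv => ?_
  rcases v with w | v
  · exact hinf w
  · by_cases hvS : v ∈ S
    · exact hS v hvS
    · have hvq : v ≠ q := fun h => hv (by rw [h])
      exact StepFour.localTerm_inr_eq_zero_of_mem_unramifiedSubgroup inv ρ v (hI v hvS hvq) (hID v hvS hvq)
        (hx v hvS hvq) (hy v hvS hvq)

/-! ## (H-P) `tr × ur` perfectness at `v ∤ n` for a PRIME-POWER `n` (incl. `n = 2`), no `Odd n`: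
`…X9LocalTransversePerfect.eq_zero_of_mem_transverse_of_forall_unramified_pairing_eq_zero` uses `tr ⊥ tr`, which
FAILS at `2` (`(ϖ,ϖ)_2 = (−1)^{(q−1)/2}`); the `2`-adic proof is `ur^⊥ ⊆ ur`
(`UnramifiedSelfDual.mem_unramifiedSubgroup_of_forall_pairing_eq_zero`, `IsPrimePow n`) + `ur ⊓ tr = ⊥`
(`LocalSplitPrime.unramifiedSubgroup_inf_transverseSubgroup_cyclotomicField_eq_bot`). -/

/-- (H-P, size S) a transverse class pairing to zero with every unramified dual class is zero, `n` a prime power. -/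
theorem eq_zero_of_mem_transverse_of_forall_unramified_pairing_eq_zero_primePow
    {K : Type u} [Field K] [NumberField K] {M : Type u} [AddCommGroup M] [TopologicalSpace M]
    [DiscreteTopology M] [Finite M] (ρ : DiscreteGaloisModule K M) {n : ℕ} [NeZero n]
    (inv : LocalInvariants K n) (v : HeightOneSpectrum (𝓞 K)) (ℓ : ℕ) [Fact ℓ.Prime]
    [NeZero ((ℓ : ℕ) : v.adicCompletion K)]
    (hn : IsPrimePow n) (hperf : inv.IsPerfect) (hMn : ∀ m : M, n • m = 0)
    (hv : ((n : ℕ) : 𝓞 K) ∉ v.asIdeal)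
    (hI : ∀ t ∈ absInertia (v.adicCompletion K), ∀ m : M, GaloisRep.toLocal v ρ t m = m)
    (hχI : ∀ u : (ZMod ℓ)ˣ, ∃ t ∈ absInertia (v.adicCompletion K),
      modPCyclotomicCharacterZMod (v.adicCompletion K) ℓ t = u)
    {a : galoisCohomology (GaloisRep.toLocal v ρ) 1}
    (ha : a ∈ DiscreteGaloisModule.transverseSubgroup (GaloisRep.toLocal v ρ)
      (CyclotomicField ℓ (v.adicCompletion K)))
    (h0 : ∀ b ∈ DiscreteGaloisModule.unramifiedSubgroup (GaloisRep.toLocal v (ρ.tateDual n)) 1,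
      DiscreteGaloisModule.localTatePairingZMod ρ n (Sum.inr v) (inv (Sum.inr v)) a b = 0) :
    a = 0 := by
  sorry

/-! ## (H-F) no `Gal(ℚ̄/ℚ(μ_ℓ))`-fixed vector on `E[2]` when `ρ̄₂` is onto (image `S₃` is non-abelian; replaces
`TameSeams.torsionGaloisModule_eq_zero_of_forall_rootsOfUnityFixer_apply_eq (hp2) (hirr)`). -/

/-- (H-F, size S) -/
theorem torsionGaloisModule_two_eq_zero_of_forall_rootsOfUnityFixer_apply_eq (W : WeierstrassCurve ℚ)
    [W.IsElliptic] (h2 : W.HasSurjectiveModNGaloisRep 2) (ℓ : ℕ) [NeZero ℓ] :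
    ∀ m : geomTorsion W (2 : ℤ),
      (∀ g ∈ rootsOfUnityFixer ℚ ℓ, W.torsionGaloisModule (2 : ℤ) g m = m) → m = 0 := by
  sorry

/-! ## (H-0) bottom coefficient of the twisted action: `(σ ·_{𝒯_J} x)₀ = σ • x₀` (the twist is `≡ 1 mod T`). -/

/-- (H-0, size XS) from `modPTwist_apply` + `unipotentPow_apply_zero`. -/
theorem modPTwist_apply_zero (W : WeierstrassCurve ℚ) [W.IsElliptic] (κ : ZpExtension ℚ 2) {J : ℕ}
    (hJ : 0 < J) (σ : absoluteGaloisGroup ℚ) (x : Fin J → geomTorsion W (2 : ℤ)) :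
    W.modPTwist 2 κ J σ x ⟨0, hJ⟩ = σ • x ⟨0, hJ⟩ := by
  rw [WeierstrassCurve.modPTwist_apply, ZpExtension.unipotentPow_apply_zero]

/-! ## (H-C) STEPS 1+2 in rank one: a Chebotarev prime `q ∉ S` whose Frobenius is a TRANSPOSITION on `E[2]`, of depth `≥ n`,
with NON-DEGENERATE bottom pairing `e₂((ρ̄(Fr) − 1)·κ̄′(Fr), ψ̄(Fr)) ≠ 0` (replaces `exists_jointValue_weil_ne_zero_of_ne_two` +
`exists_isArithFrobAt_mem_inf_ker_apply_eq_and_depth_of_ne_two`; no exact depth, no E-split prime, no Goursat). -/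

/-- (H-C, size L, load-bearing #2) -/
def ChebotarevTranspositionTwo : Prop :=
  ∀ (W : WeierstrassCurve ℚ) [W.IsElliptic] [W.IsGloballyMinimal] (κ : ZpExtension ℚ 2)
    (γ : absoluteGaloisGroup ℚ),
    W.HasSurjectiveModNGaloisRep 2 → W.Δ < 0 → κ.IsCyclotomic → κ.IsTopGenerator γ →
    ∀ (κ' : κ.twistTower (W.torsionGaloisModule (2 : ℤ))
        (fun P : WeierstrassCurve.geomTorsion W (2 : ℤ) => AddSubgroup.torsionBy.nsmul P)),
      κ.towerConst (W.torsionGaloisModule (2 : ℤ)) (fun P => AddSubgroup.torsionBy.nsmul P) κ' ≠ 0 →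
    ∀ (J : ℕ) (φ : contOneCocycles (W.modPTwist 2 κ (J + 1)).toTopRep),
      oneCocycleClass (W.modPTwist 2 κ (J + 1)).toTopRep φ = κ'.1 (J + 1) →
    ∀ (ψ : contOneCocycles (W.modPTwist 2 κ.invTwist (J + 1)).toTopRep),
      (κ.invTwist.shiftH1 (W.torsionGaloisModule (2 : ℤ))
          (fun P : WeierstrassCurve.geomTorsion W (2 : ℤ) => AddSubgroup.torsionBy.nsmul P) (J + 1))^[J]
        (oneCocycleClass (W.modPTwist 2 κ.invTwist (J + 1)).toTopRep ψ) ≠ 0 →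
    ∀ (eW : WeierstrassCurve.geomTorsion W (2 : ℤ) → WeierstrassCurve.geomTorsion W (2 : ℤ) →
        AlgebraicClosure ℚ)
      (hμ : ∀ S T, eW S T ^ 2 = 1)
      (hadd₁ : ∀ S₁' S₂' T, eW (S₁' + S₂') T = eW S₁' T * eW S₂' T)
      (hadd₂ : ∀ S T₁ T₂, eW S (T₁ + T₂) = eW S T₁ * eW S T₂),
      (∀ T, eW T T = 1) → (∀ T, (∀ S, eW S T = 1) → T = 0) →
      (∀ (σ : absoluteGaloisGroup ℚ) (S T : WeierstrassCurve.geomTorsion W (2 : ℤ)),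
        σ • eW S T = eW (σ • S) (σ • T)) →
    ∀ (S : Set (HeightOneSpectrum (𝓞 ℚ))), S.Finite → ∀ (n : ℕ),
    ∃ q : HeightOneSpectrum (𝓞 ℚ), q ∉ S ∧ ∃ 𝔓 ∈ q.primesAbove, ∃ Fr : absoluteGaloisGroup ℚ,
      IsArithFrobAt (𝓞 ℚ) Fr 𝔓 ∧
      WeierstrassCurve.galoisRepTorsion W 2 Fr ≠ 1 ∧ WeierstrassCurve.galoisRepTorsion W 2 (Fr * Fr) = 1 ∧
      Fr ∈ κ.layerSubgroup n ∧
      weilPairingHom W 2 eW hμ hadd₁ hadd₂ (Fr • φ.1 Fr ⟨0, Nat.succ_pos J⟩ - φ.1 Fr ⟨0, Nat.succ_pos J⟩)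
        (ψ.1 Fr ⟨0, Nat.succ_pos J⟩) ≠ 0

/-! ## (H-K) STEPS 3–4 in rank one at `2`: the Kolyvagin class of ONE transposition prime and the reciprocity law.
From a GENUINE `2`-adic class (`IsEulerSystemClassTwo`), for a transposition Frobenius `Fr ∈ Γ^{2^n}`, `J ≤ 2^n`
(so `γ_q` acts trivially on `Ω_J(χ)`, `Fr − 1 = (τ − 1) ⊗ 1 =: N`, `N² = 0`, `ker N = im N ≅ Ω_J`,
`P_q(x) ≡ (1 + x)²`, `φ^{fs} = unit·N̄` an ISO — sketch §1 `ker_frobMinusOne_eq_range`), the Poitou–Tate sum for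
`(κ_q, Ψ)` gives: all convolution coefficients `< J − ε` of `e(U·T^a·N(Φ(Fr)), Ψc(Fr))` vanish. -/

/-- (H-K, size XL, load-bearing #1; the stub to register) -/
def KolyvaginRankOneTwo : Prop :=
  ∀ (W : WeierstrassCurve ℚ) [W.IsElliptic] [W.IsGloballyMinimal]
    [ContinuousSMul ℤ_[2] (W.tateModule 2)] [Module.Free ℤ_[2] (W.tateModule 2)]
    [Module.Finite ℤ_[2] (W.tateModule 2)]
    (κ : ZpExtension ℚ 2) (γ : absoluteGaloisGroup ℚ) (I : IwasawaH1Data W 2 κ γ) (hκ : κ.IsCyclotomic),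
    W.HasSurjectiveModNGaloisRep 2 → W.Δ < 0 → κ.IsTopGenerator γ →
    poitouTate_sum_localTatePairing_eq_zero ℚ →
    ∀ (s : I.H), IsEulerSystemClassTwo W hκ I s →
    ∃ (S₀ : Set (HeightOneSpectrum (𝓞 ℚ))), S₀.Finite ∧
      ∀ (a : ℕ) (κ' : κ.twistTower (W.torsionGaloisModule (2 : ℤ))
          (fun P : WeierstrassCurve.geomTorsion W (2 : ℤ) => AddSubgroup.torsionBy.nsmul P)),
        (κ.towerShift (W.torsionGaloisModule (2 : ℤ))
            (fun P : WeierstrassCurve.geomTorsion W (2 : ℤ) => AddSubgroup.torsionBy.nsmul P))^[a]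
          κ' = I.redTower s →
        ∀ (J n : ℕ), J ≤ 2 ^ n →
        ∀ (Φ : contOneCocycles (W.modPTwist 2 κ J).toTopRep),
          oneCocycleClass (W.modPTwist 2 κ J).toTopRep Φ = κ'.1 J →
        ∀ (ε : ℕ) (S₁ : Set (HeightOneSpectrum (𝓞 ℚ)))
          (Ψ : galoisCohomology (W.modPTwist 2 κ.invTwist J) 1)
          (Ψc : contOneCocycles (W.modPTwist 2 κ.invTwist J).toTopRep),
          S₀ ⊆ S₁ →
          oneCocycleClass (W.modPTwist 2 κ.invTwist J).toTopRep Ψc = Ψ →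
          (∀ v : HeightOneSpectrum (𝓞 ℚ), v ∉ S₁ →
            galoisCohomology.localization (W.modPTwist 2 κ.invTwist J) (Sum.inr v) 1 Ψ ∈
              DiscreteGaloisModule.unramifiedSubgroup
                (GaloisRep.toLocal v (W.modPTwist 2 κ.invTwist J)) 1) →
          (∀ v : HeightOneSpectrum (𝓞 ℚ), v ∈ S₁ →
            galoisCohomology.localization (W.modPTwist 2 κ.invTwist J) (Sum.inr v) 1
              ((κ.invTwist.shiftH1 (W.torsionGaloisModule (2 : ℤ))
                (fun P : WeierstrassCurve.geomTorsion W (2 : ℤ) => AddSubgroup.torsionBy.nsmul P)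
                J)^[ε] Ψ) = 0) →
        ∀ (eW : WeierstrassCurve.geomTorsion W (2 : ℤ) → WeierstrassCurve.geomTorsion W (2 : ℤ) →
            AlgebraicClosure ℚ)
          (hμ : ∀ S T, eW S T ^ 2 = 1)
          (hadd₁ : ∀ S₁' S₂' T, eW (S₁' + S₂') T = eW S₁' T * eW S₂' T)
          (hadd₂ : ∀ S T₁ T₂, eW S (T₁ + T₂) = eW S T₁ * eW S T₂),
          (∀ T, eW T T = 1) → (∀ T, (∀ S, eW S T = 1) → T = 0) →
          (∀ (σ : absoluteGaloisGroup ℚ) (S T : WeierstrassCurve.geomTorsion W (2 : ℤ)),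
            σ • eW S T = eW (σ • S) (σ • T)) →
        ∀ (q : HeightOneSpectrum (𝓞 ℚ)), q ∉ S₁ →
        ∀ 𝔓 ∈ q.primesAbove, ∀ (Fr : absoluteGaloisGroup ℚ), IsArithFrobAt (𝓞 ℚ) Fr 𝔓 →
          WeierstrassCurve.galoisRepTorsion W 2 Fr ≠ 1 → WeierstrassCurve.galoisRepTorsion W 2 (Fr * Fr) = 1 →
          Fr ∈ κ.layerSubgroup n →
        ∃ U : Polynomial ℤ, ¬ (((2 : ℕ) : ℤ) ∣ U.coeff 0) ∧
          ∀ i : ℕ, i + ε < J →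
            convCoeff (weilPairingHom W 2 eW hμ hadd₁ hadd₂) J i
              (Polynomial.aeval (shiftEnd (WeierstrassCurve.geomTorsion W (2 : ℤ)) J) U
                ((shiftEnd (WeierstrassCurve.geomTorsion W (2 : ℤ)) J ^ a)
                  (W.modPTwist 2 κ J Fr (Φ.1 Fr) - Φ.1 Fr)))
              (Ψc.1 Fr) = 0

/-! ## The composition (mirror of `coreOdd_of_selmerDual_of_stepsTwoFour`, ll.171–262): Step 0 (tree, any `p`) →
`J := a + ε + 2`, `n` with `2^n ≥ J` → bad class `y` (by contradiction) → `Ψ` (H-S) → `Φ` of `κ'_J` → (H-C) a transposition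
prime with `e₂((ρ̄(Fr)−1)Φ(Fr)₀, Ψc(Fr)₀) ≠ 0` → (H-K) vanishing of the convolution coefficients → the count
`convCoeff_zero_one_eq_zero_of_reciprocity` (tree, `m := a`, needs `a + 1 + ε < J`) + `convCoeff_zero_eq` + (H-0) → ⊥. -/
theorem coreTwoResidue_of_rankOne (hred : mem_pSmul_of_red_eq_zero)
    (hPT : poitouTate_sum_localTatePairing_eq_zero ℚ)
    (hG1 : SelmerSideTwo) (hC : ChebotarevTranspositionTwo) (hK : KolyvaginRankOneTwo) :
    CoreTheoremATwoResidue := by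
  intro W _ _ _ _ _ κ γ I hκ _ _ h2 hΔ hγ hs
  obtain ⟨s, hES, hsp⟩ := hs
  have hirr : W.HasIrreducibleModPGaloisRep 2 := hasIrreducibleModPGaloisRep_of_hasSurjectiveModNGaloisRep W 2 h2
  -- STEP 0 (tree, any prime): `red_Ω s = T^a κ'`, `κ̄' ≠ 0`
  have ht : I.redTower s ≠ 0 := I.redTower_ne_zero_of_not_mem hred hκ hγ hsp
  obtain ⟨a, κ', hκ'a, -, hκ'c⟩ :=
    LevelE.exists_towerShift_iterate_eq_and_towerConst_ne_zero W 2 κ hirr ht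
  -- Steps 3–4 (H-K): the bad set `S₀`; the Selmer side (H-S): `ε`, `S₁ ⊇ S₀`
  obtain ⟨S₀, hS₀, hK'⟩ := hK W κ γ I hκ h2 hΔ hγ hPT s hES
  obtain ⟨ε, S₁, hS₁, hS₀₁, hG1'⟩ := hG1 W κ γ h2 hκ hγ S₀ hS₀
  -- a Weil pairing on `E[2]`
  obtain ⟨eW, hμ, hadd₁, hadd₂, halt, hnondeg, hgal⟩ := W.exists_weilPairing_holds 2 le_rfl (by norm_num)
  -- suppose the conclusion fails; level `J = e + 1 = a + ε + 2`, depth `n := e + 1` (`J ≤ 2^n`)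
  by_contra hcon
  push Not at hcon
  set e : ℕ := a + ε + 1 with he
  have hJn : e + 1 ≤ 2 ^ (e + 1) := (Nat.lt_pow_self (by norm_num)).le
  obtain ⟨y, hy, hyT⟩ := hcon e
  obtain ⟨Ψ, hΨT, hΨur, hΨε⟩ := hG1' e y hy hyT
  obtain ⟨Ψc, hΨc⟩ := oneCocycleClass_surjective _ Ψ
  subst hΨc
  obtain ⟨Φ, hΦ⟩ := oneCocycleClass_surjective _ (κ'.1 (e + 1))
  -- STEPS 1+2 in rank one (H-C): a transposition prime `q ∉ S₁` of depth `≥ e + 1`, non-degenerate bottom pairing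
  obtain ⟨q, hq, 𝔓, h𝔓, Fr, hFr, hFr1, hFr2, hFrn, hne⟩ :=
    hC W κ γ h2 hΔ hκ hγ κ' hκ'c e Φ hΦ Ψc hΨT eW hμ hadd₁ hadd₂ halt hnondeg hgal S₁ hS₁ (e + 1)
  -- STEPS 3–4 in rank one (H-K): the Kolyvagin class of `q` and reciprocity
  obtain ⟨U, hU0, hrec⟩ := hK' a κ' hκ'a (e + 1) (e + 1) hJn Φ hΦ ε S₁ _ Ψc hS₀₁ rfl hΨur hΨε eW hμ hadd₁
    hadd₂ halt hnondeg hgal q hq 𝔓 h𝔓 Fr hFr hFr1 hFr2 hFrn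
  -- the count (tree): `C_0 = 0` for the pair `(N Φ(Fr), Ψc(Fr))`
  have hpC : ∀ c : DiscreteGaloisModule.MuCarrier ℚ 2, ((2 : ℕ) : ℤ) • c = 0 :=
    natCast_zsmul_muCarrier_eq_zero ℚ 2
  obtain ⟨hC0, -⟩ := convCoeff_zero_one_eq_zero_of_reciprocity (weilPairingHom W 2 eW hμ hadd₁ hadd₂)
    Nat.prime_two hpC (m := a) (ε := ε) (by omega) U hU0 _ (Ψc.1 Fr) hrec
  rw [convCoeff_zero_eq _ (by omega), Pi.sub_apply, modPTwist_apply_zero] at hC0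
  exact hne hC0


/-- How the lead plugs it in (reshape v5): `stub_port` from three registered stubs and two TREE facts. -/
theorem stub_port_of_rankOne (hG1 : SelmerSideTwo) (hC : ChebotarevTranspositionTwo) (hK : KolyvaginRankOneTwo) :
    CoreTheoremATwoResidue :=
  coreTwoResidue_of_rankOne mem_pSmul_of_red_eq_zero_holds (poitouTate_sum_localTatePairing_eq_zero_holds ℚ) hG1 hC hK

end Summit.BirchSwinnertonDyer.BirchSwinnertonDyer.Cruxes.OrdKatoHalfAtTwoIso.SignBlindKolyvaginPrimes

end
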